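import Summits.KontsevichZagierPeriods.KontsevichZagierPeriods.Theorems.SoloInformedKZStokesSimplex
import Summits.KontsevichZagierPeriods.KontsevichZagierPeriods.Theorems.SoloInformedKZStokesCube
import Summits.KontsevichZagierPeriods.KontsevichZagierPeriods.Theorems.SoloInformedKZUnitCube
import HarnessLib

/-!
# SoloInformed — closed-form KZ–Stokes: the boundary of a cell carries no period

**Lemma H (homology invariance engine).**  Let `Δ = Δᵐ⁺¹`, `W ⊇ Δ` open, `g₀, …, g_m` functions
`ℚ`-semialgebraic and `C¹` on `W`, and suppose the `m`-form
`ω = Σᵢ (−1)ⁱ gᵢ dz₀ ∧ … ∧ \widehat{dzᵢ} ∧ … ∧ dz_m` is **closed on the simplex**,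
`Σᵢ (−1)ⁱ ∂ᵢ gᵢ = 0` on `Δ`.  Then the signed sum of the facet representations

  `[Δᵐ, Σᵢ (−1)ⁱ gᵢ ∘ ∂⁰] − Σᵢ (−1)ⁱ [Δᵐ, gᵢ ∘ ∂ᶻᵢ]`

lies in `KZ.relations` (`soloInformed_kzStokes_simplex_closed`): *the boundary of a simplex carries
no period of a closed form*.  The same holds for the cube `[0,1]ᵐ⁺¹`: if `Σᵢ (−1)ⁱ ∂ᵢ gᵢ = 0` on the
cube then `Σᵢ (−1)ⁱ ([[0,1]ᵐ, gᵢ|_{zᵢ=1}] − [[0,1]ᵐ, gᵢ|_{zᵢ=0}]) ∈ KZ.relations`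
(`soloInformed_kzStokes_cube_closed`).  Numerically, the signed sums of the facet integrals vanish
(`…_value`), and the facet representations exist (`…_exists`).

These are immediate from the KZ–Stokes engines (`soloInformed_kzStokes_simplex`,
`soloInformed_kzStokes_cube`) and rule (1b) with zero integrand, but they are the form in which
Stokes is *used*: applied to the pull-back `τ*α` of a closed algebraic `m`-form `α` along a
semialgebraic `C²` singular `(m+1)`-simplex `τ` (so that the coefficients `gᵢ` of `τ*α` are `C¹`,
semialgebraic, and `Σ (−1)ⁱ∂ᵢgᵢ = 0` by `dα = 0`), Lemma H says that the KZ class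
`Σⱼ nⱼ [Δᵐ, σⱼ*α]` of a semialgebraic `C²` singular `m`-cycle `Σ nⱼ σⱼ` depends only on its
homology class in the region where `α` is regular.  This is the engine of THEOREM XXVI of the
solo-informed programme (Riemann's bilinear relations — the cup product on `H¹` of a curve — are
theorems of the Kontsevich–Zagier calculus), see the programme notes §6duodecies.
[Kontsevich–Zagier 2001, §1.2; Ayoub 2014, EMS Newsl. 91, §2.2; Huber–Müller-Stach 2017, Ch. 12]
-/

noncomputable section

open scoped BigOperators
open Set MeasureTheory
open Literature.NumberTheory.Transcendental Literature.NumberTheory.Transcendental.KZ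
open Literature.ModelTheory.ExponentialFields (IsSemialgebraic)

namespace Summit.KontsevichZagierPeriods.KontsevichZagierPeriods.Theorems

/-! ### The simplex -/

/-- **Lemma H on the simplex (closed-form KZ–Stokes).**  If `Σᵢ (−1)ⁱ ∂ᵢ gᵢ = 0` on `Δᵐ⁺¹` for
`gᵢ` `ℚ`-semialgebraic and `C¹` on an open `W ⊇ Δᵐ⁺¹`, then for any representations `rF l` on
`Δᵐ` with integrands `Σᵢ (−1)ⁱ gᵢ ∘ ∂⁰` (`l = 0`) and `gᵢ ∘ ∂ᶻᵢ` (`l = i+1`),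
`Σₗ (−1)ˡ [rF l] ∈ KZ.relations`: the boundary of a simplex carries no period of a closed form.
[Kontsevich–Zagier 2001, §1.2] -/
theorem soloInformed_kzStokes_simplex_closed {m : ℕ} {W : Set (Fin (m + 1) → ℝ)} (hW : IsOpen W)
    (hΔW : soloInformedSimplex (m + 1) ⊆ W) {g : Fin (m + 1) → (Fin (m + 1) → ℝ) → ℝ}
    (hgs : ∀ i, IsSemialgebraicFunOn ℚ W (g i)) (hgd : ∀ i, ContDiffOn ℝ 1 (g i) W)
    (hclosed : ∀ z ∈ soloInformedSimplex (m + 1),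
      ∑ i : Fin (m + 1), (-1 : ℝ) ^ (i : ℕ) * fderiv ℝ (g i) z (Pi.single i 1) = 0)
    (rF : Fin (m + 2) → IntegralRep m) (hFd : ∀ l, (rF l).domain = soloInformedSimplex m)
    (hF0 : EqOn (rF 0).integrand
      (fun s => ∑ i : Fin (m + 1), (-1 : ℝ) ^ (i : ℕ) * g i (soloInformedObliqueFace s))
      (soloInformedSimplex m))
    (hFs : ∀ i : Fin (m + 1), EqOn (rF i.succ).integrand (fun s => g i (soloInformedCoordFace i s))
      (soloInformedSimplex m)) :
    ∑ l : Fin (m + 2), ((-1 : ℤ) ^ (l : ℕ)) • of (rF l) ∈ relations := by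
  have hΔ := isSemialgebraic_soloInformedSimplex (m + 1)
  -- the zero representation on the simplex
  let rD : IntegralRep (m + 1) := soloInformedSimplexRep (m + 1) (fun _ => (0 : ℝ))
    (by simpa using isSemialgebraicFunOn_ratCast hΔ 0) continuousOn_const
  have hDi : EqOn rD.integrand
      (fun z => ∑ i : Fin (m + 1), (-1 : ℝ) ^ (i : ℕ) * fderiv ℝ (g i) z (Pi.single i 1))
      (soloInformedSimplex (m + 1)) := fun z hz => by
    simp only [rD, soloInformedSimplexRep_integrand]
    exact (hclosed z hz).symm
  have h := soloInformed_kzStokes_simplex hW hΔW hgs hgd rD rfl hDi rF hFd hF0 hFs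
  have h0 : of rD ∈ relations :=
    soloInformed_of_mem_relations_of_integrand_zero rD fun _ _ => rfl
  have key : ∑ l : Fin (m + 2), ((-1 : ℤ) ^ (l : ℕ)) • of (rF l) =
      of rD - (of rD - ∑ l : Fin (m + 2), ((-1 : ℤ) ^ (l : ℕ)) • of (rF l)) := by abel
  rw [key]
  exact relations.sub_mem h0 h

/-- **Lemma H on the simplex, as numbers**: the signed sum of the facet integrals of a closed form
vanishes, `Σₗ (−1)ˡ ∫_{Δᵐ} (rF l) = 0`. -/
theorem soloInformed_stokes_simplex_closed_value {m : ℕ} {W : Set (Fin (m + 1) → ℝ)} (hW : IsOpen W)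
    (hΔW : soloInformedSimplex (m + 1) ⊆ W) {g : Fin (m + 1) → (Fin (m + 1) → ℝ) → ℝ}
    (hgs : ∀ i, IsSemialgebraicFunOn ℚ W (g i)) (hgd : ∀ i, ContDiffOn ℝ 1 (g i) W)
    (hclosed : ∀ z ∈ soloInformedSimplex (m + 1),
      ∑ i : Fin (m + 1), (-1 : ℝ) ^ (i : ℕ) * fderiv ℝ (g i) z (Pi.single i 1) = 0)
    (rF : Fin (m + 2) → IntegralRep m) (hFd : ∀ l, (rF l).domain = soloInformedSimplex m)
    (hF0 : EqOn (rF 0).integrand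
      (fun s => ∑ i : Fin (m + 1), (-1 : ℝ) ^ (i : ℕ) * g i (soloInformedObliqueFace s))
      (soloInformedSimplex m))
    (hFs : ∀ i : Fin (m + 1), EqOn (rF i.succ).integrand (fun s => g i (soloInformedCoordFace i s))
      (soloInformedSimplex m)) :
    ∑ l : Fin (m + 2), (-1 : ℝ) ^ (l : ℕ) * (rF l).value = 0 := by
  have h := relations_le_ker_eval_holds
    (soloInformed_kzStokes_simplex_closed hW hΔW hgs hgd hclosed rF hFd hF0 hFs)
  rw [AddMonoidHom.mem_ker, map_sum] at h
  rw [← h]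
  refine Finset.sum_congr rfl fun l _ => ?_
  rw [map_zsmul, eval_of, zsmul_eq_mul]
  push_cast
  ring

/-- **Existence of the facet representations** of Lemma H on the simplex (so that it is not
vacuous), together with the relation. -/
theorem soloInformed_kzStokes_simplex_closed_exists {m : ℕ} {W : Set (Fin (m + 1) → ℝ)}
    (hW : IsOpen W) (hΔW : soloInformedSimplex (m + 1) ⊆ W)
    {g : Fin (m + 1) → (Fin (m + 1) → ℝ) → ℝ}
    (hgs : ∀ i, IsSemialgebraicFunOn ℚ W (g i)) (hgd : ∀ i, ContDiffOn ℝ 1 (g i) W)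
    (hclosed : ∀ z ∈ soloInformedSimplex (m + 1),
      ∑ i : Fin (m + 1), (-1 : ℝ) ^ (i : ℕ) * fderiv ℝ (g i) z (Pi.single i 1) = 0) :
    ∃ rF : Fin (m + 2) → IntegralRep m,
      (∀ l, (rF l).domain = soloInformedSimplex m) ∧
      ((rF 0).integrand =
        fun s => ∑ i : Fin (m + 1), (-1 : ℝ) ^ (i : ℕ) * g i (soloInformedObliqueFace s)) ∧
      (∀ i : Fin (m + 1), (rF i.succ).integrand = fun s => g i (soloInformedCoordFace i s)) ∧
      ∑ l : Fin (m + 2), ((-1 : ℤ) ^ (l : ℕ)) • of (rF l) ∈ relations := by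
  obtain ⟨rD, rF, -, -, hFd, hF0, hFs, -⟩ := soloInformed_kzStokes_simplex_exists hW hΔW hgs hgd
  exact ⟨rF, hFd, hF0, hFs, soloInformed_kzStokes_simplex_closed hW hΔW hgs hgd hclosed rF hFd
    (fun s _ => by rw [hF0]) fun i s _ => by rw [hFs i]⟩

/-! ### The cube -/

/-- **Lemma H on the cube (closed-form KZ–Stokes).**  If `Σᵢ (−1)ⁱ ∂ᵢ gᵢ = 0` on `[0,1]ᵐ⁺¹` for
`gᵢ` `ℚ`-semialgebraic and `C¹` on an open `W ⊇ [0,1]ᵐ⁺¹`, then for any representations on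
`[0,1]ᵐ` with integrands `gᵢ(insertNth i 1 ·)` (`rT i`) and `gᵢ(insertNth i 0 ·)` (`rB i`),
`Σᵢ (−1)ⁱ ([rT i] − [rB i]) ∈ KZ.relations`: the boundary of a cube carries no period of a closed
form. [Kontsevich–Zagier 2001, §1.2; Ayoub 2014, §2.2] -/
theorem soloInformed_kzStokes_cube_closed {m : ℕ} {W : Set (Fin (m + 1) → ℝ)} (hW : IsOpen W)
    (hCW : soloInformedCube (m + 1) ⊆ W) {g : Fin (m + 1) → (Fin (m + 1) → ℝ) → ℝ}
    (hgs : ∀ i, IsSemialgebraicFunOn ℚ W (g i)) (hgd : ∀ i, ContDiffOn ℝ 1 (g i) W)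
    (hclosed : ∀ z ∈ soloInformedCube (m + 1),
      ∑ i : Fin (m + 1), (-1 : ℝ) ^ (i : ℕ) * fderiv ℝ (g i) z (Pi.single i 1) = 0)
    (rT rB : Fin (m + 1) → IntegralRep m)
    (hTd : ∀ i, (rT i).domain = soloInformedCube m) (hBd : ∀ i, (rB i).domain = soloInformedCube m)
    (hTi : ∀ i, EqOn (rT i).integrand (fun s => g i (Fin.insertNth i 1 s)) (soloInformedCube m))
    (hBi : ∀ i, EqOn (rB i).integrand (fun s => g i (Fin.insertNth i 0 s)) (soloInformedCube m)) :
    ∑ i : Fin (m + 1), ((-1 : ℤ) ^ (i : ℕ)) • (of (rT i) - of (rB i)) ∈ relations := by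
  have hC := isSemialgebraic_soloInformedCube (m + 1)
  have hd : ∀ i, ∀ z ∈ W, DifferentiableAt ℝ (g i) z := fun i z hz =>
    ((hgd i).differentiableOn one_ne_zero z hz).differentiableAt (hW.mem_nhds hz)
  have hDs : ∀ i, IsSemialgebraicFunOn ℚ (soloInformedCube (m + 1))
      (fun z => fderiv ℝ (g i) z (Pi.single i 1)) :=
    fun i => ((hgs i).fderiv_apply_single hW (hd i) i).mono hCW hC
  have hDc : ∀ i, ContinuousOn (fun z => fderiv ℝ (g i) z (Pi.single i 1))
      (soloInformedCube (m + 1)) :=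
    fun i => (((hgd i).continuousOn_fderiv_of_isOpen hW le_rfl).clm_apply continuousOn_const).mono hCW
  let D : Fin (m + 1) → IntegralRep (m + 1) := fun i => soloInformedCubeRep (m + 1) _ (hDs i) (hDc i)
  -- the zero representation on the cube
  let Z : IntegralRep (m + 1) := soloInformedCubeRep (m + 1) (fun _ => (0 : ℝ))
    (by simpa using isSemialgebraicFunOn_ratCast hC 0) continuousOn_const
  have hε : ∀ i : Fin (m + 1), ((-1 : ℤ) ^ (i : ℕ)) = 1 ∨ ((-1 : ℤ) ^ (i : ℕ)) = -1 :=
    fun i => soloInformed_neg_one_pow_eq_or i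
  have hA : of Z - ∑ i : Fin (m + 1), ((-1 : ℤ) ^ (i : ℕ)) • of (D i) ∈ relations :=
    soloInformed_of_sub_signedSum_mem_relations Z D _ hε (fun i => rfl) fun z hz => by
      have hz' : z ∈ soloInformedCube (m + 1) := hz
      simp only [Z, D, soloInformedCubeRep_integrand]
      push_cast
      exact (hclosed z hz').symm
  have hZ : of Z ∈ relations :=
    soloInformed_of_mem_relations_of_integrand_zero Z fun _ _ => rfl
  have hB : ∀ i : Fin (m + 1), of (D i) - (of (rT i) - of (rB i)) ∈ relations := fun i =>
    soloInformed_kzStokes_cube hW hCW (hgs i) (hgd i) i (D i) rfl (fun _ _ => rfl) (rT i) (rB i)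
      (hTd i) (hBd i) (hTi i) (hBi i)
  have key : ∑ i : Fin (m + 1), ((-1 : ℤ) ^ (i : ℕ)) • (of (rT i) - of (rB i)) =
      of Z - (of Z - ∑ i : Fin (m + 1), ((-1 : ℤ) ^ (i : ℕ)) • of (D i)) -
        ∑ i : Fin (m + 1), ((-1 : ℤ) ^ (i : ℕ)) • (of (D i) - (of (rT i) - of (rB i))) := by
    simp only [smul_sub, Finset.sum_sub_distrib]
    abel
  rw [key]
  exact relations.sub_mem (relations.sub_mem hZ hA) (sum_mem fun i _ => relations.zsmul_mem (hB i) _)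

/-- **Lemma H on the cube, as numbers**: `Σᵢ (−1)ⁱ (∫ rT i − ∫ rB i) = 0`. -/
theorem soloInformed_stokes_cube_closed_value {m : ℕ} {W : Set (Fin (m + 1) → ℝ)} (hW : IsOpen W)
    (hCW : soloInformedCube (m + 1) ⊆ W) {g : Fin (m + 1) → (Fin (m + 1) → ℝ) → ℝ}
    (hgs : ∀ i, IsSemialgebraicFunOn ℚ W (g i)) (hgd : ∀ i, ContDiffOn ℝ 1 (g i) W)
    (hclosed : ∀ z ∈ soloInformedCube (m + 1),
      ∑ i : Fin (m + 1), (-1 : ℝ) ^ (i : ℕ) * fderiv ℝ (g i) z (Pi.single i 1) = 0)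
    (rT rB : Fin (m + 1) → IntegralRep m)
    (hTd : ∀ i, (rT i).domain = soloInformedCube m) (hBd : ∀ i, (rB i).domain = soloInformedCube m)
    (hTi : ∀ i, EqOn (rT i).integrand (fun s => g i (Fin.insertNth i 1 s)) (soloInformedCube m))
    (hBi : ∀ i, EqOn (rB i).integrand (fun s => g i (Fin.insertNth i 0 s)) (soloInformedCube m)) :
    ∑ i : Fin (m + 1), (-1 : ℝ) ^ (i : ℕ) * ((rT i).value - (rB i).value) = 0 := by
  have h := relations_le_ker_eval_holds
    (soloInformed_kzStokes_cube_closed hW hCW hgs hgd hclosed rT rB hTd hBd hTi hBi)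
  rw [AddMonoidHom.mem_ker, map_sum] at h
  rw [← h]
  refine Finset.sum_congr rfl fun i _ => ?_
  rw [map_zsmul, map_sub, eval_of, eval_of, zsmul_eq_mul]
  push_cast
  ring

/-- **Existence of the facet representations** of Lemma H on the cube, with the relation. -/
theorem soloInformed_kzStokes_cube_closed_exists {m : ℕ} {W : Set (Fin (m + 1) → ℝ)}
    (hW : IsOpen W) (hCW : soloInformedCube (m + 1) ⊆ W)
    {g : Fin (m + 1) → (Fin (m + 1) → ℝ) → ℝ}
    (hgs : ∀ i, IsSemialgebraicFunOn ℚ W (g i)) (hgd : ∀ i, ContDiffOn ℝ 1 (g i) W)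
    (hclosed : ∀ z ∈ soloInformedCube (m + 1),
      ∑ i : Fin (m + 1), (-1 : ℝ) ^ (i : ℕ) * fderiv ℝ (g i) z (Pi.single i 1) = 0) :
    ∃ rT rB : Fin (m + 1) → IntegralRep m,
      (∀ i, (rT i).domain = soloInformedCube m) ∧ (∀ i, (rB i).domain = soloInformedCube m) ∧
      (∀ i, (rT i).integrand = fun s => g i (Fin.insertNth i 1 s)) ∧
      (∀ i, (rB i).integrand = fun s => g i (Fin.insertNth i 0 s)) ∧
      ∑ i : Fin (m + 1), ((-1 : ℤ) ^ (i : ℕ)) • (of (rT i) - of (rB i)) ∈ relations := by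
  have h := fun i => soloInformed_kzStokes_cube_exists hW hCW (hgs i) (hgd i) i
  choose rD rT rB hDd hDi hTd hTi hBd hBi hrel using h
  exact ⟨rT, rB, hTd, hBd, hTi, hBi, soloInformed_kzStokes_cube_closed hW hCW hgs hgd hclosed rT rB
    hTd hBd (fun i s _ => by rw [hTi i]) fun i s _ => by rw [hBi i]⟩

end Summit.KontsevichZagierPeriods.KontsevichZagierPeriods.Theorems

end
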